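import Mathlib
import Summits.KontsevichZagierPeriods.Zeta5Search.KDigitWeights
import HarnessLib

/-!
# ζ(5) search — the `𝒦`-weights ONE ORDER FURTHER: `g₂ − 1`, the Fermat quotient under a level shift mod `p²` (DENOM-LAW D1, prover-d1 gen 19)

HONEST FRAMING: systematic search; no irrationality claim unless certified.  Cell `pub-zeta5`, track «DENOM-LAW» D1, seat
`denom-prover-d1` gen 19 (`HOME/denom-law/prover-d1/ATTEMPT-19.md`).  Arithmetic input of the CLASSWISE SECOND `𝒦`-DIGIT
(`KSecondDigit.lean`, the `𝒦`-analogue of gen-2 g10's (W2) `secondDigitW_holds`), i.e. the Taylor coefficients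
`g_o(k) = [(t+k)^o](t^p − t)²` (`taylorTT`) one `p`-adic order beyond `KDigitWeights.lean` (typer g9):

* `taylorTT_one_eq`       : `g₁(k) = 2pφ_k(1 − p·k^{p−1})` exactly (`φ_k = fq p k = (k^p − k)/p`);
* `taylorTT_two_sub`      : `g₂(k) − 1 = p·k^{p−1}·((2p−1)k^{p−1} − (p+1))` exactly;
* `kappa_sq_dvd`          : `p ∣ (k^{p−1})² − k^{p−1}` (Fermat);
* `pow_pred_shift_dvd`    : `p ∣ (k+pℓ)^{p−1} − k^{p−1}`;
* `cube_dvd_add_mul_pow`  : `p³ ∣ (k+pℓ)^p − k^p − p²ℓk^{p−1}` (binomial theorem, `p ∣ C(p,2)`);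
* `fq_shift_two_dvd`      : `p² ∣ φ_{k+pℓ} − (φ_k − ℓ + pℓk^{p−1})` — the level shift of the Fermat quotient to SECOND order;
* `taylorTT_two_shift_dvd`: `p² ∣ (g₂(k+pℓ) − 1) + 2p·k^{p−1}`;
and their `padicNorm` forms.  Elementary congruences of integers; nothing about irrationality, nothing about ζ(5).
-/

namespace Summit.KontsevichZagierPeriods.Zeta5Search.ClusterValuation

open Finset
open Summit.KontsevichZagierPeriods.Zeta5Search.PadicSeries

section IntFacts

variable {p : ℕ}

/-- **`g₁(k) = 2pφ_k(1 − p k^{p−1})`** exactly (from `taylorTT_one_sub`). -/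
theorem taylorTT_one_eq_mul (hp : p.Prime) (hp2 : p ≠ 2) (k : ℤ) :
    taylorTT p 1 k = 2 * (p : ℤ) * fq p k * (1 - (p : ℤ) * k ^ (p - 1)) := by
  have h := taylorTT_one_sub hp hp2 k
  linear_combination h

/-- **`g₂(k) − 1 = p·k^{p−1}·((2p−1)k^{p−1} − (p+1))`** (odd prime `p`). -/
theorem taylorTT_two_sub (hp : p.Prime) (hp2 : p ≠ 2) (k : ℤ) :
    taylorTT p 2 k - 1 = (p : ℤ) * k ^ (p - 1) * ((2 * (p : ℤ) - 1) * k ^ (p - 1) - ((p : ℤ) + 1)) := by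
  obtain ⟨m, hm⟩ : ∃ m, p = m + 1 := ⟨p - 1, (Nat.sub_add_cancel hp.one_le).symm⟩
  have hodd : Odd p := hp.odd_of_ne_two hp2
  have hmeven : Even m := by
    subst hm; obtain ⟨r, hr⟩ := hodd; exact ⟨r, by omega⟩
  -- the two binomial coefficients, doubled
  have h1 : ((2 * p).choose 2 : ℤ) * 2 = 2 * (p : ℤ) * (2 * (p : ℤ) - 1) := by
    have h := Nat.add_one_mul_choose_eq (2 * p - 1) 1
    rw [Nat.choose_one_right, show 2 * p - 1 + 1 = 2 * p by omega] at h
    have h' : (((2 * p) * (2 * p - 1) : ℕ) : ℤ) = (((2 * p).choose 2 * 2 : ℕ) : ℤ) := by exact_mod_cast h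
    push_cast [Nat.cast_sub (show 1 ≤ 2 * p by omega)] at h'
    linarith
  have h2 : ((p + 1).choose 2 : ℤ) * 2 = ((p : ℤ) + 1) * (p : ℤ) := by
    have h := Nat.add_one_mul_choose_eq p 1
    rw [Nat.choose_one_right] at h
    have h' : (((p + 1) * p : ℕ) : ℤ) = (((p + 1).choose (1 + 1) * (1 + 1) : ℕ) : ℤ) := by exact_mod_cast h
    push_cast at h'
    linarith
  have hT : taylorTT p 2 k = ((2 * p).choose 2 : ℤ) * k ^ (2 * m) - 2 * ((p + 1).choose 2 : ℤ) * k ^ m + 1 := by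
    rw [taylorTT]
    have e1 : 2 * p - 2 = 2 * m := by omega
    have e2 : p + 1 - 2 = m := by omega
    rw [e1, e2, show (2 : ℕ).choose 2 = 1 from rfl, show (2 : ℕ) - 2 = 0 from rfl, pow_zero,
      (show Even (2 * m) from even_two_mul m).neg_pow, hmeven.neg_pow]
    push_cast
    ring
  have hpm : p - 1 = m := by omega
  rw [hpm]
  apply mul_left_cancel₀ (two_ne_zero : (2 : ℤ) ≠ 0)
  rw [show (2 : ℤ) * (taylorTT p 2 k - 1) = (((2 * p).choose 2 : ℤ) * 2) * k ^ (2 * m)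
      - 2 * (((p + 1).choose 2 : ℤ) * 2) * k ^ m by rw [hT]; ring, h1, h2, pow_mul]
  ring

/-- **`p ∣ (k^{p−1})² − k^{p−1}`** (both sides `≡ 1` if `p ∤ k`, `≡ 0` if `p ∣ k`): `= k^{p−2}(k^p − k)`. -/
theorem kappa_sq_dvd (hp : p.Prime) (k : ℤ) : (p : ℤ) ∣ (k ^ (p - 1)) ^ 2 - k ^ (p - 1) := by
  obtain ⟨n, hn⟩ : ∃ n, p = n + 2 := ⟨p - 2, (Nat.sub_add_cancel hp.two_le).symm⟩
  have h := natPrime_dvd_pow_sub_self hp k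
  subst hn
  rw [show n + 2 - 1 = n + 1 by omega]
  have e : (k ^ (n + 1)) ^ 2 - k ^ (n + 1) = k ^ n * (k ^ (n + 2) - k) := by ring
  rw [e]
  exact Dvd.dvd.mul_left h _

/-- **`p ∣ (k + pℓ)^{p−1} − k^{p−1}`**. -/
theorem pow_pred_shift_dvd (p : ℕ) (k ℓ : ℤ) : (p : ℤ) ∣ (k + p * ℓ) ^ (p - 1) - k ^ (p - 1) := by
  have h : k ≡ k + p * ℓ [ZMOD p] := Int.modEq_iff_dvd.2 ⟨ℓ, by ring⟩
  exact (Int.ModEq.dvd (h.pow (p - 1)))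

/-- **`p³ ∣ (k+pℓ)^p − k^p − p²ℓk^{p−1}`** (`p ≥ 3` prime; binomial theorem and `p ∣ C(p,2)`). -/
theorem cube_dvd_add_mul_pow (hp : p.Prime) (h3 : 3 ≤ p) (k ℓ : ℤ) :
    (p : ℤ) ^ 3 ∣ (k + p * ℓ) ^ p - k ^ p - (p : ℤ) ^ 2 * ℓ * k ^ (p - 1) := by
  rw [add_pow, sum_range_succ, show range p = range (p - 1 + 1) by rw [Nat.sub_add_cancel hp.one_le], sum_range_succ,
    Nat.sub_self, pow_zero, Nat.choose_self, show p - (p - 1) = 1 by omega, pow_one, Nat.choose_symm hp.one_le,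
    Nat.choose_one_right]
  have e : (∑ m ∈ range (p - 1), k ^ m * ((p : ℤ) * ℓ) ^ (p - m) * (p.choose m : ℤ))
      + k ^ (p - 1) * ((p : ℤ) * ℓ) * ((p : ℕ) : ℤ) + k ^ p * 1 * ((1 : ℕ) : ℤ) - k ^ p - (p : ℤ) ^ 2 * ℓ * k ^ (p - 1)
      = ∑ m ∈ range (p - 1), k ^ m * ((p : ℤ) * ℓ) ^ (p - m) * (p.choose m : ℤ) := by
    push_cast; ring
  rw [e]
  refine dvd_sum fun m hm => ?_
  have hm' : m < p - 1 := mem_range.1 hm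
  by_cases h2 : m = p - 2
  · -- the term `(pℓ)² C(p, p−2)`: `p ∣ C(p, p−2)`
    subst h2
    have hC : (p : ℤ) ∣ (p.choose (p - 2) : ℤ) := by
      exact_mod_cast hp.dvd_choose_self (by omega) (by omega)
    obtain ⟨c, hc⟩ := hC
    rw [show p - (p - 2) = 2 by omega, hc]
    exact ⟨k ^ (p - 2) * ℓ ^ 2 * c, by ring⟩
  · -- `p − m ≥ 3`
    have h3' : 3 ≤ p - m := by omega
    obtain ⟨r, hr⟩ : ∃ r, p - m = r + 3 := ⟨p - m - 3, by omega⟩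
    rw [hr, pow_add]
    exact ⟨k ^ m * ((p : ℤ) * ℓ) ^ r * ℓ ^ 3 * (p.choose m : ℤ), by ring⟩

/-- **`p² ∣ φ_{k+pℓ} − (φ_k − ℓ + pℓk^{p−1})`**: the level shift of the Fermat quotient to second order. -/
theorem fq_shift_two_dvd (hp : p.Prime) (h3 : 3 ≤ p) (k ℓ : ℤ) :
    (p : ℤ) ^ 2 ∣ fq p (k + p * ℓ) - (fq p k - ℓ + (p : ℤ) * ℓ * k ^ (p - 1)) := by
  have hp0 : (p : ℤ) ≠ 0 := by exact_mod_cast hp.ne_zero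
  obtain ⟨c, hc⟩ := cube_dvd_add_mul_pow hp h3 k ℓ
  refine ⟨c, ?_⟩
  have h1 := p_mul_fq hp (k + p * ℓ)
  have h2 := p_mul_fq hp k
  have : (p : ℤ) * (fq p (k + p * ℓ) - (fq p k - ℓ + (p : ℤ) * ℓ * k ^ (p - 1))) = (p : ℤ) * ((p : ℤ) ^ 2 * c) := by
    rw [mul_sub, h1, show (p : ℤ) * (fq p k - ℓ + (p : ℤ) * ℓ * k ^ (p - 1)) =
      (p : ℤ) * fq p k - p * ℓ + (p : ℤ) ^ 2 * ℓ * k ^ (p - 1) by ring, h2]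
    linear_combination hc
  exact mul_left_cancel₀ hp0 this

/-- **`p² ∣ (g₂(k+pℓ) − 1) + 2p·k^{p−1}`** (odd prime `p`): `g₂ − 1 ≡ −2p·k^{p−1} (mod p²)`, constant along a residue class. -/
theorem taylorTT_two_shift_dvd (hp : p.Prime) (hp2 : p ≠ 2) (k ℓ : ℤ) :
    (p : ℤ) ^ 2 ∣ (taylorTT p 2 (k + p * ℓ) - 1) + 2 * (p : ℤ) * k ^ (p - 1) := by
  set K := k + p * ℓ with hK
  rw [taylorTT_two_sub hp hp2 K]
  obtain ⟨a, ha⟩ := kappa_sq_dvd hp K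
  obtain ⟨c, hc⟩ := pow_pred_shift_dvd p k ℓ
  rw [← hK] at hc
  refine ⟨2 * K ^ (p - 1) * K ^ (p - 1) - K ^ (p - 1) - a - 2 * c, ?_⟩
  linear_combination (-(p : ℤ)) * ha + (-2 * (p : ℤ)) * hc

end IntFacts

/-! ### `p`-adic norm forms -/

section Norms

variable {p : ℕ} [hp : Fact p.Prime]

/-- From `p^n ∣ z` to `‖z‖_p ≤ p^{−n}`. -/
theorem padicNorm_le_of_pow_dvd {z : ℤ} {n : ℕ} (h : (p : ℤ) ^ n ∣ z) : padicNorm p (z : ℚ) ≤ (p : ℚ) ^ (-(n : ℤ)) := by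
  have := padicNorm.dvd_iff_norm_le.1 (show ((p ^ n : ℕ) : ℤ) ∣ z by exact_mod_cast h)
  simpa using this

/-- `g₁(k) = 2pφ_k(1 − p k^{p−1})` in `ℚ`. -/
theorem taylorTT_one_cast (hp2 : p ≠ 2) (k : ℤ) :
    ((taylorTT p 1 k : ℤ) : ℚ) = 2 * (p : ℚ) * (fq p k : ℚ) * (1 - (p : ℚ) * (k : ℚ) ^ (p - 1)) := by
  rw [taylorTT_one_eq_mul hp.out hp2 k]; push_cast; ring

/-- `g₂(k) − 1 = p·γ_k`, `γ_k := k^{p−1}((2p−1)k^{p−1} − (p+1))`, in `ℚ`. -/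
theorem taylorTT_two_cast (hp2 : p ≠ 2) (k : ℤ) :
    ((taylorTT p 2 k : ℤ) : ℚ) - 1 =
      (p : ℚ) * ((k : ℚ) ^ (p - 1) * ((2 * (p : ℚ) - 1) * (k : ℚ) ^ (p - 1) - ((p : ℚ) + 1))) := by
  have h := taylorTT_two_sub hp.out hp2 k
  have h' : (((taylorTT p 2 k - 1 : ℤ)) : ℚ) =
      (((p : ℤ) * k ^ (p - 1) * ((2 * (p : ℤ) - 1) * k ^ (p - 1) - ((p : ℤ) + 1)) : ℤ) : ℚ) := by rw [h]
  push_cast at h'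
  linear_combination h'

/-- `‖φ_{k+pℓ} − (φ_k − ℓ + pℓk^{p−1})‖_p ≤ p^{−2}` (`p ≥ 3`). -/
theorem padicNorm_fq_shift_two_le (hp2 : p ≠ 2) (k ℓ : ℤ) :
    padicNorm p ((fq p (k + p * ℓ) : ℚ) - ((fq p k : ℚ) - ℓ + (p : ℚ) * ℓ * (k : ℚ) ^ (p - 1))) ≤ (p : ℚ) ^ (-(2 : ℤ)) := by
  have h3 : 3 ≤ p := by have := hp.out.two_le; omega
  have h := fq_shift_two_dvd hp.out h3 k ℓ
  have hcast : ((fq p (k + p * ℓ) : ℚ) - ((fq p k : ℚ) - ℓ + (p : ℚ) * ℓ * (k : ℚ) ^ (p - 1))) =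
      (((fq p (k + p * ℓ) - (fq p k - ℓ + (p : ℤ) * ℓ * k ^ (p - 1)) : ℤ)) : ℚ) := by push_cast; ring
  rw [hcast]
  exact_mod_cast padicNorm_le_of_pow_dvd h

/-- `‖(k+pℓ)^{p−1} − k^{p−1}‖_p ≤ p^{−1}`. -/
theorem padicNorm_pow_pred_shift_le (k ℓ : ℤ) :
    padicNorm p ((((k + p * ℓ : ℤ)) : ℚ) ^ (p - 1) - (k : ℚ) ^ (p - 1)) ≤ (p : ℚ) ^ (-(1 : ℤ)) := by
  have h := pow_pred_shift_dvd p k ℓ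
  have hcast : ((((k + p * ℓ : ℤ)) : ℚ) ^ (p - 1) - (k : ℚ) ^ (p - 1)) = ((((k + p * ℓ) ^ (p - 1) - k ^ (p - 1) : ℤ)) : ℚ) := by
    push_cast; ring
  rw [hcast]
  have := padicNorm_le_of_pow_dvd (p := p) (n := 1) (by simpa using h)
  simpa using this

/-- `‖(g₂(k+pℓ) − 1) + 2p·k^{p−1}‖_p ≤ p^{−2}`. -/
theorem padicNorm_taylorTT_two_shift_le (hp2 : p ≠ 2) (k ℓ : ℤ) :
    padicNorm p ((((taylorTT p 2 (k + p * ℓ) : ℤ)) : ℚ) - 1 + 2 * (p : ℚ) * (k : ℚ) ^ (p - 1)) ≤ (p : ℚ) ^ (-(2 : ℤ)) := by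
  have h := taylorTT_two_shift_dvd hp.out hp2 k ℓ
  have hcast : ((((taylorTT p 2 (k + p * ℓ) : ℤ)) : ℚ) - 1 + 2 * (p : ℚ) * (k : ℚ) ^ (p - 1)) =
      ((((taylorTT p 2 (k + p * ℓ) - 1) + 2 * (p : ℤ) * k ^ (p - 1) : ℤ)) : ℚ) := by push_cast; ring
  rw [hcast]
  exact_mod_cast padicNorm_le_of_pow_dvd h

/-- `‖k^{p−1}‖_p ≤ 1` for an integer `k`. -/
theorem padicNorm_int_pow_le_one (k : ℤ) (n : ℕ) : padicNorm p ((k : ℚ) ^ n) ≤ 1 := by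
  have := padicNorm.of_int (p := p) (k ^ n)
  push_cast at this
  exact this

end Norms

end Summit.KontsevichZagierPeriods.Zeta5Search.ClusterValuation
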